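import Summits.QuantumAdvantage.QuantumAdvantage.Theorems.SosSandwichPseudoBoundedAAChebyshevVariance
import Summits.QuantumAdvantage.QuantumAdvantage.Theorems.SosSandwichPseudoBoundedAAChebyshevInfluence
import Summits.QuantumAdvantage.QuantumAdvantage.Theorems.SosSandwichPseudoBoundedAAChebyshevBinomial
import Mathlib.Analysis.SpecialFunctions.Trigonometric.Bounds
import Mathlib.Analysis.Real.Pi.Bounds

/-!
# Route `SosSandwich`, crux `PseudoBoundedAA` (stmt-QuantumAdvantage-15237) — the `T`-SIDE EXPONENT
CALIBRATION, completed: no influence law with linear loss in `T` holds on the SOS sandwich class `K`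

Helper (`--supports stmt-QuantumAdvantage-15237`), conjecture-free, no named facts. Fourth and last file of
the Chebyshev-family package (`…ChebyshevFamily.lean`: `p_k = T_k(ȳ)² ∈ K_k`, exact variance identity;
`…ChebyshevInfluence.lean`: `Infᵢ[p_k] ≤ 4/N + 25k²/N²`; `…ChebyshevVariance.lean`: two-window variance
floor). This file assembles the calibration on the instance `k = 12r`, `N = k²`; the CLT-free binomial input (§1–§2 below) lives in `SosSandwichPseudoBoundedAAChebyshevBinomial.lean`.

* §1 BINOMIAL WINDOW BOUNDS (elementary): `16^n ≤ 4n·C(2n,n)²` (`sixteen_pow_le_centralBinom_sq`, i.e.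
  `C(2n,n)/4^n ≥ 1/(2√n)`, induction with `(n+1)C(2n+2,n+1) = 2(2n+1)C(2n,n)` and `(2n+1)² ≥ 4n(n+1)`);
  `(n − t²)·C(2n,n) ≤ n·C(2n,n+t)` (`centralBinom_ratio_lower`, telescoping); hence
  `(1 − c)²·16^n ≤ 4n·C(2n,n+t)²` whenever `t² ≤ c·n` (`sixteen_pow_le_choose_sq`).
* §2 COUNTING LAYER: `#{x ∈ {0,1}^N : wt x = j} = C(N,j)` (`card_filter_weight_eq_choose`), window
  probabilities from weights (`sum_choose_div_le_boolAvg`), `ȳ = (N − 2·wt)/N` (`signMeanVal_eq_weight`).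
* §3 THE CALIBRATING INSTANCE `k = 12r`, `N = k² = 144r²`, `n = 72r²`: per-weight bound
  `C(N, n+t)/2^N ≥ (1 − c)/(18r)` for `t² ≤ c·n` (`choose_window_lower`, using `√n ≤ 9r`), window sums
  (`window_sum_lower`), and the two phase windows in weight form: `wt ∈ [n, n+2r] ⟹ |ȳ| ≤ 1/(36r) ≤
  sin(π/(6k))` (`central_window_of_weight`, Jordan's inequality) and `wt ∈ [n+7r, n+8r] ⟹
  sin(π/(3k)) ≤ 7/(72r) ≤ |ȳ| ≤ 1/(9r) ≤ sin(2π/(3k))` (`offcentre_window_of_weight`; `sin x ≤ x`,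
  `π < 3.15`, Jordan).
* §4 ASSEMBLY: `Var[p_k] ≥ 1/2592` on the calibrating instance (`boolVariance_chebyshevT_sq_ge_const`:
  central window `P ≥ 17/162`, off-centre `P ≥ 1/162`, floor `(1/16)·min`); the calibrating triple
  **`p_k ∈ K_k ∧ Var[p_k] ≥ 1/2592 ∧ ∀ i, Infᵢ[p_k] ≤ 29/k²`** for `k = 12r`, `N = k²`, every `r ≥ 1`
  (`chebyshev_calibration`); and the law-level consequence
  **`not_influence_law_linear_in_T`**: `¬ ∃ a C > 0, ∀ p ∈ K_T (T ≥ 1, Var > 0), maxᵢ Infᵢ ≥ C·Var^a/T`.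

MEANING FOR THE CRUX (honest label: calibration, not a proof of `PseudoBoundedAA`). Together with the
`Var`-side calibration already in the tree (`SosSandwichHomogeneousPBAATExponent.lean`: `a ≥ 2` forced by
the disjointly averaged address family; `…ExponentCorner.lean` / `…Averaging.lean`: on the TOP-HOMOGENEOUS
class the corner law `maxInf ≥ C·Var²/T` is consistent and attained with equality, `Infᵢ = 16·Var²/T`), this
file shows the corner law of the top level is FALSE on the full class `K`: off the top Fourier level the
`T`-loss of any Aaronson–Ambainis-type influence bound for SOS-sandwiched polynomials is at least QUADRATIC.
Hence `(a, b) = (2, 2)` — `maxInf ≥ C·Var²/T²`, the idea card's prediction "forced by the one-query mean and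
by Grover + check" — is the unique strongest candidate law on `K` consistent with every family in the tree,
and in the single-exponent item `PseudoBoundedAA` (`C·(ε/T)^c`) the exponent `c ≥ 2` is forced from the
`T`-side as well as from the `ε`-side. For the registered line `birth` of the crux this calibrates
`stub_levelDescent`: any level descent to the flat base classes must lose at least a factor `T` in the
variance-to-influence conversion beyond the top-homogeneous rung.

Sources: amplitude amplification / the polynomial method [cite: BealsEtAl2001, §4]; the class `K_T`
[cite: KaniewskiLeeDewolf2015, Def. 7, Thm. 12]; binomial estimates and Jordan's inequality [folklore];
route file `Theses/SosSandwich.lean` (NUMBERS: "Prediction (card): maxInf_L² ≥ c·Var²/T² on K_T").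
-/

set_option linter.dupNamespace false

noncomputable section

namespace Summit.QuantumAdvantage.QuantumAdvantage.Theorems.SosSandwich

open Finset
open Literature.Computability.QuantumComplexity

variable {N : ℕ}

/-! ### §3 The calibrating instance `k = 12r`, `N = k² = 144r²`: both phase windows have constant probability -/

/-- Per-weight lower bound on the calibrating instance: for `t² ≤ c·72r²`,
`(1 − c)·4^{72r²} ≤ 18r · C(144r², 72r² + t)` (i.e. `C(N, n+t)/2^N ≥ (1 − c)/(18r)`). [folklore] -/
theorem choose_window_lower (r t : ℕ) (hr : 1 ≤ r) {c : ℝ} (hc1 : c ≤ 1)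
    (ht : (t : ℝ) ^ 2 ≤ c * (72 * r ^ 2 : ℕ)) :
    (1 - c) * (4 : ℝ) ^ (72 * r ^ 2) ≤ 18 * r * ((144 * r ^ 2).choose (72 * r ^ 2 + t) : ℝ) := by
  have hn : 1 ≤ 72 * r ^ 2 := by nlinarith
  have h := sixteen_pow_le_choose_sq (72 * r ^ 2) t hn hc1 ht
  rw [show 2 * (72 * r ^ 2) = 144 * r ^ 2 by ring] at h
  have hr1 : (1 : ℝ) ≤ r := by exact_mod_cast hr
  set C := (((144 * r ^ 2).choose (72 * r ^ 2 + t) : ℕ) : ℝ) with hC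
  have hC0 : 0 ≤ C := Nat.cast_nonneg _
  have h16 : (16 : ℝ) ^ (72 * r ^ 2) = ((4 : ℝ) ^ (72 * r ^ 2)) ^ 2 := by
    rw [← pow_mul, show (16 : ℝ) = 4 ^ 2 by norm_num, ← pow_mul]; ring_nf
  have hsq : ((1 - c) * (4 : ℝ) ^ (72 * r ^ 2)) ^ 2 ≤ (18 * r * C) ^ 2 := by
    have h4n : (4 : ℝ) * ((72 * r ^ 2 : ℕ) : ℝ) ≤ (18 * r) ^ 2 := by push_cast; nlinarith
    calc ((1 - c) * (4 : ℝ) ^ (72 * r ^ 2)) ^ 2 = (1 - c) ^ 2 * 16 ^ (72 * r ^ 2) := by rw [h16]; ring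
      _ ≤ 4 * ((72 * r ^ 2 : ℕ) : ℝ) * C ^ 2 := h
      _ ≤ (18 * r) ^ 2 * C ^ 2 := by nlinarith [sq_nonneg C]
      _ = (18 * r * C) ^ 2 := by ring
  have h1c : 0 ≤ 1 - c := by linarith
  exact (pow_le_pow_iff_left₀ (by positivity) (by positivity) two_ne_zero).mp hsq

/-- Window sums on the calibrating instance: for weights `72r² + t`, `t ∈ [t₁, t₂]` with `t₂² ≤ c·72r²`,
`Σ_j C(N, j)/2^N ≥ (t₂ + 1 − t₁)·(1 − c)/(18r)`. [folklore] -/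
theorem window_sum_lower (r t₁ t₂ : ℕ) (hr : 1 ≤ r) {c : ℝ} (hc1 : c ≤ 1)
    (ht : (t₂ : ℝ) ^ 2 ≤ c * (72 * r ^ 2 : ℕ)) :
    ((t₂ + 1 - t₁ : ℕ) : ℝ) * ((1 - c) / (18 * r)) ≤
      (∑ j ∈ Finset.Icc (72 * r ^ 2 + t₁) (72 * r ^ 2 + t₂), ((144 * r ^ 2).choose j : ℝ)) /
        (2 : ℝ) ^ (144 * r ^ 2) := by
  have hr0 : (0 : ℝ) < r := by exact_mod_cast (show 0 < r by omega)
  have h2N : (2 : ℝ) ^ (144 * r ^ 2) = (4 : ℝ) ^ (72 * r ^ 2) := by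
    rw [show (4 : ℝ) = 2 ^ 2 by norm_num, ← pow_mul]; ring_nf
  rw [Finset.sum_div]
  have hcard : (Finset.Icc (72 * r ^ 2 + t₁) (72 * r ^ 2 + t₂)).card = t₂ + 1 - t₁ := by
    rw [Nat.card_Icc]; omega
  have hterm : ∀ j ∈ Finset.Icc (72 * r ^ 2 + t₁) (72 * r ^ 2 + t₂),
      (1 - c) / (18 * r) ≤ ((144 * r ^ 2).choose j : ℝ) / (2 : ℝ) ^ (144 * r ^ 2) := by
    intro j hj
    rw [Finset.mem_Icc] at hj
    obtain ⟨t, rfl⟩ : ∃ t, j = 72 * r ^ 2 + t := ⟨j - 72 * r ^ 2, by omega⟩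
    have ht2 : t ≤ t₂ := by omega
    have htt : (t : ℝ) ^ 2 ≤ c * (72 * r ^ 2 : ℕ) := by
      have : (t : ℝ) ≤ t₂ := by exact_mod_cast ht2
      have ht0 : (0 : ℝ) ≤ t := Nat.cast_nonneg t
      nlinarith
    have hw := choose_window_lower r t hr hc1 htt
    rw [h2N, div_le_div_iff₀ (by positivity) (by positivity)]
    linarith
  have := Finset.card_nsmul_le_sum _ _ _ hterm
  rw [hcard, nsmul_eq_mul] at this
  exact this

/-- CENTRAL WINDOW on the calibrating instance (`k = 12r`, `N = 144r²`): weights in `[72r², 72r² + 2r]`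
give `|ȳ| ≤ 1/(36r) ≤ sin(π/(6k))` (Jordan's inequality). [folklore] -/
theorem central_window_of_weight (r : ℕ) (hr : 1 ≤ r) (x : Fin (144 * r ^ 2) → Bool)
    (hx : (Finset.univ.filter (fun i => x i = true)).card ∈ Finset.Icc (72 * r ^ 2) (72 * r ^ 2 + 2 * r)) :
    |(1 / ((144 * r ^ 2 : ℕ) : ℝ)) * ∑ i, (1 - 2 * (if x i then (1 : ℝ) else 0))| ≤
      Real.sin (Real.pi / (6 * (4 * (3 * r) : ℕ))) := by
  have hr0 : (0 : ℝ) < r := by exact_mod_cast (show 0 < r by omega)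
  have hpi := Real.pi_pos
  rw [signMeanVal_eq_weight]
  rw [Finset.mem_Icc] at hx
  set w := (Finset.univ.filter (fun i => x i = true)).card with hw
  have hw1 : (72 * r ^ 2 : ℝ) ≤ (w : ℝ) := by exact_mod_cast hx.1
  have hw2 : (w : ℝ) ≤ 72 * r ^ 2 + 2 * r := by exact_mod_cast hx.2
  -- `|ȳ| ≤ 1/(36 r)`
  have hy : |(((144 * r ^ 2 : ℕ) : ℝ) - 2 * (w : ℝ)) / ((144 * r ^ 2 : ℕ) : ℝ)| ≤ 1 / (36 * r) := by
    push_cast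
    have habs : |(144 * (r : ℝ) ^ 2) - 2 * (w : ℝ)| ≤ 4 * (r : ℝ) :=
      abs_le.mpr ⟨by nlinarith, by nlinarith⟩
    rw [abs_div, abs_of_pos (by positivity : (0 : ℝ) < 144 * (r : ℝ) ^ 2)]
    calc |(144 * (r : ℝ) ^ 2) - 2 * (w : ℝ)| / (144 * (r : ℝ) ^ 2) ≤ 4 * (r : ℝ) / (144 * (r : ℝ) ^ 2) :=
          div_le_div_of_nonneg_right habs (by positivity)
      _ = 1 / (36 * r) := by field_simp; ring
  -- Jordan: `sin(π/(72 r)) ≥ (2/π)·(π/(72 r)) = 1/(36 r)`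
  have harg : Real.pi / (6 * (4 * (3 * r) : ℕ)) = Real.pi / (72 * r) := by push_cast; ring
  rw [harg]
  have hr1 : (1 : ℝ) ≤ r := by exact_mod_cast hr
  have hj := Real.mul_le_sin (by positivity : (0 : ℝ) ≤ Real.pi / (72 * r))
    (by rw [div_le_div_iff₀ (by positivity) (by norm_num)]; nlinarith [mul_le_mul_of_nonneg_left hr1 hpi.le])
  have : 2 / Real.pi * (Real.pi / (72 * r)) = 1 / (36 * r) := by field_simp; ring
  rw [this] at hj
  exact hy.trans hj

/-- OFF-CENTRE WINDOW on the calibrating instance: weights in `[72r² + 7r, 72r² + 8r]` give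
`sin(π/(3k)) ≤ 7/(72r) ≤ |ȳ| ≤ 1/(9r) ≤ sin(2π/(3k))` (`sin x ≤ x`, `π ≤ 3.15`, Jordan). [folklore] -/
theorem offcentre_window_of_weight (r : ℕ) (hr : 1 ≤ r) (x : Fin (144 * r ^ 2) → Bool)
    (hx : (Finset.univ.filter (fun i => x i = true)).card ∈
      Finset.Icc (72 * r ^ 2 + 7 * r) (72 * r ^ 2 + 8 * r)) :
    Real.sin (Real.pi / (3 * (4 * (3 * r) : ℕ))) ≤
        |(1 / ((144 * r ^ 2 : ℕ) : ℝ)) * ∑ i, (1 - 2 * (if x i then (1 : ℝ) else 0))| ∧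
      |(1 / ((144 * r ^ 2 : ℕ) : ℝ)) * ∑ i, (1 - 2 * (if x i then (1 : ℝ) else 0))| ≤
        Real.sin (2 * Real.pi / (3 * (4 * (3 * r) : ℕ))) := by
  have hr0 : (0 : ℝ) < r := by exact_mod_cast (show 0 < r by omega)
  have hpi := Real.pi_pos
  have hpi3 := Real.pi_lt_d2
  rw [signMeanVal_eq_weight]
  rw [Finset.mem_Icc] at hx
  set w := (Finset.univ.filter (fun i => x i = true)).card with hw
  have hw1 : (72 * r ^ 2 + 7 * r : ℝ) ≤ (w : ℝ) := by exact_mod_cast hx.1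
  have hw2 : (w : ℝ) ≤ 72 * r ^ 2 + 8 * r := by exact_mod_cast hx.2
  have hval : |(((144 * r ^ 2 : ℕ) : ℝ) - 2 * (w : ℝ)) / ((144 * r ^ 2 : ℕ) : ℝ)| =
      (2 * (w : ℝ) - 144 * r ^ 2) / (144 * r ^ 2) := by
    push_cast
    rw [abs_div, abs_of_pos (by positivity : (0 : ℝ) < 144 * r ^ 2)]
    congr 1
    rw [abs_of_nonpos (by nlinarith)]
    ring
  rw [hval]
  have harg1 : Real.pi / (3 * (4 * (3 * r) : ℕ)) = Real.pi / (36 * r) := by push_cast; ring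
  have harg2 : 2 * Real.pi / (3 * (4 * (3 * r) : ℕ)) = Real.pi / (18 * r) := by
    push_cast; field_simp; ring
  rw [harg1, harg2]
  constructor
  · -- `sin(π/(36r)) ≤ π/(36r) ≤ 7/(72r) ≤ |ȳ|`
    have hs := Real.sin_le (by positivity : (0 : ℝ) ≤ Real.pi / (36 * r))
    have h7 : Real.pi / (36 * r) ≤ (2 * (w : ℝ) - 144 * r ^ 2) / (144 * r ^ 2) := by
      rw [div_le_div_iff₀ (by positivity) (by positivity)]
      nlinarith
    exact hs.trans h7
  · -- `|ȳ| ≤ 1/(9r) ≤ sin(π/(18r))` (Jordan)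
    have hr1 : (1 : ℝ) ≤ r := by exact_mod_cast hr
    have hj := Real.mul_le_sin (by positivity : (0 : ℝ) ≤ Real.pi / (18 * r))
      (by rw [div_le_div_iff₀ (by positivity) (by norm_num)]; nlinarith [mul_le_mul_of_nonneg_left hr1 hpi.le])
    have : 2 / Real.pi * (Real.pi / (18 * r)) = 1 / (9 * r) := by field_simp; ring
    rw [this] at hj
    have h9 : (2 * (w : ℝ) - 144 * r ^ 2) / (144 * r ^ 2) ≤ 1 / (9 * r) := by
      rw [div_le_div_iff₀ (by positivity) (by positivity)]
      nlinarith
    exact h9.trans hj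

/-! ### §4 Assembly: constant variance, `O(1/k²)` influences — the `T`-exponent of PB-AA is at least `2` -/

/-- **Variance floor on the calibrating instance**: for `k = 12r`, `N = k² = 144r²` (`r ≥ 1`),
`Var[p_k] ≥ 1/2592`. (Central window: `P ≥ 17/162`; off-centre window: `P ≥ 1/162`; two-window lemma.)
[folklore] -/
theorem boolVariance_chebyshevT_sq_ge_const (r : ℕ) (hr : 1 ≤ r) :
    (1 / 2592 : ℝ) ≤ boolVariance ((Polynomial.aeval (∑ i : Fin (144 * r ^ 2),
        (MvPolynomial.C (1 / ((144 * r ^ 2 : ℕ) : ℝ)) -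
          MvPolynomial.C (2 / ((144 * r ^ 2 : ℕ) : ℝ)) * MvPolynomial.X i))
        (Polynomial.Chebyshev.T ℝ ((4 * (3 * r) : ℕ) : ℤ))) ^ 2) := by
  classical
  have hN : 1 ≤ 144 * r ^ 2 := by nlinarith
  have hr0 : (0 : ℝ) < r := by exact_mod_cast (show 0 < r by omega)
  have hvar := boolVariance_chebyshevT_sq_ge_two_window (N := 144 * r ^ 2) (3 * r) (by omega) hN
  -- central window probability `≥ 17/162`
  have hA : (17 / 162 : ℝ) ≤ boolAvg (fun x : Fin (144 * r ^ 2) → Bool =>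
      if |(1 / ((144 * r ^ 2 : ℕ) : ℝ)) * ∑ i, (1 - 2 * (if x i then (1 : ℝ) else 0))| ≤
          Real.sin (Real.pi / (6 * (4 * (3 * r) : ℕ))) then (1 : ℝ) else 0) := by
    have h1 := sum_choose_div_le_boolAvg (N := 144 * r ^ 2)
      (fun x : Fin (144 * r ^ 2) → Bool =>
        |(1 / ((144 * r ^ 2 : ℕ) : ℝ)) * ∑ i, (1 - 2 * (if x i then (1 : ℝ) else 0))| ≤
          Real.sin (Real.pi / (6 * (4 * (3 * r) : ℕ))))
      (Finset.Icc (72 * r ^ 2 + 0) (72 * r ^ 2 + 2 * r))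
      (fun x hx => central_window_of_weight r hr x (by simpa using hx))
    have h2 := window_sum_lower r 0 (2 * r) hr (c := 1 / 18) (by norm_num)
      (by push_cast; nlinarith)
    have h3 : (17 / 162 : ℝ) ≤ ((2 * r + 1 - 0 : ℕ) : ℝ) * ((1 - 1 / 18) / (18 * r)) := by
      rw [show ((2 * r + 1 - 0 : ℕ) : ℝ) = 2 * r + 1 by push_cast; ring]
      rw [show ((2 : ℝ) * r + 1) * ((1 - 1 / 18) / (18 * r)) = (17 / 324) * ((2 * r + 1) / r) by ring]
      have : (2 : ℝ) ≤ (2 * r + 1) / r := by rw [le_div_iff₀ hr0]; linarith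
      nlinarith
    exact h3.trans (h2.trans h1)
  -- off-centre window probability `≥ 1/162`
  have hB : (1 / 162 : ℝ) ≤ boolAvg (fun x : Fin (144 * r ^ 2) → Bool =>
      if Real.sin (Real.pi / (3 * (4 * (3 * r) : ℕ))) ≤
            |(1 / ((144 * r ^ 2 : ℕ) : ℝ)) * ∑ i, (1 - 2 * (if x i then (1 : ℝ) else 0))| ∧
          |(1 / ((144 * r ^ 2 : ℕ) : ℝ)) * ∑ i, (1 - 2 * (if x i then (1 : ℝ) else 0))| ≤
            Real.sin (2 * Real.pi / (3 * (4 * (3 * r) : ℕ))) then (1 : ℝ) else 0) := by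
    have h1 := sum_choose_div_le_boolAvg (N := 144 * r ^ 2)
      (fun x : Fin (144 * r ^ 2) → Bool =>
        Real.sin (Real.pi / (3 * (4 * (3 * r) : ℕ))) ≤
            |(1 / ((144 * r ^ 2 : ℕ) : ℝ)) * ∑ i, (1 - 2 * (if x i then (1 : ℝ) else 0))| ∧
          |(1 / ((144 * r ^ 2 : ℕ) : ℝ)) * ∑ i, (1 - 2 * (if x i then (1 : ℝ) else 0))| ≤
            Real.sin (2 * Real.pi / (3 * (4 * (3 * r) : ℕ))))
      (Finset.Icc (72 * r ^ 2 + 7 * r) (72 * r ^ 2 + 8 * r))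
      (fun x hx => offcentre_window_of_weight r hr x hx)
    have h2 := window_sum_lower r (7 * r) (8 * r) hr (c := 8 / 9) (by norm_num)
      (by push_cast; nlinarith)
    have h3 : (1 / 162 : ℝ) ≤ ((8 * r + 1 - 7 * r : ℕ) : ℝ) * ((1 - 8 / 9) / (18 * r)) := by
      rw [show ((8 * r + 1 - 7 * r : ℕ) : ℝ) = r + 1 by
        rw [show 8 * r + 1 - 7 * r = r + 1 by omega]; push_cast; ring]
      rw [show ((r : ℝ) + 1) * ((1 - 8 / 9) / (18 * r)) = (1 / 162) * ((r + 1) / r) by ring]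
      have : (1 : ℝ) ≤ (r + 1) / r := by rw [le_div_iff₀ hr0]; linarith
      nlinarith
    exact h3.trans (h2.trans h1)
  have hmin : (1 / 162 : ℝ) ≤ min
      (boolAvg (fun x : Fin (144 * r ^ 2) → Bool =>
        if |(1 / ((144 * r ^ 2 : ℕ) : ℝ)) * ∑ i, (1 - 2 * (if x i then (1 : ℝ) else 0))| ≤
            Real.sin (Real.pi / (6 * (4 * (3 * r) : ℕ))) then (1 : ℝ) else 0))
      (boolAvg (fun x : Fin (144 * r ^ 2) → Bool =>
        if Real.sin (Real.pi / (3 * (4 * (3 * r) : ℕ))) ≤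
              |(1 / ((144 * r ^ 2 : ℕ) : ℝ)) * ∑ i, (1 - 2 * (if x i then (1 : ℝ) else 0))| ∧
            |(1 / ((144 * r ^ 2 : ℕ) : ℝ)) * ∑ i, (1 - 2 * (if x i then (1 : ℝ) else 0))| ≤
              Real.sin (2 * Real.pi / (3 * (4 * (3 * r) : ℕ))) then (1 : ℝ) else 0)) :=
    le_min (by linarith) hB
  linarith [mul_le_mul_of_nonneg_left hmin (by norm_num : (0 : ℝ) ≤ 1 / 16)]

/-- **THE CALIBRATING FAMILY (T-side) for `PseudoBoundedAA`.** For every `r ≥ 1`, with `k = 12r` and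
`N = k² = 144r²`, the Chebyshev / amplitude-amplification polynomial `p_k = T_k(ȳ)²` on `N` variables is
pseudo-bounded of order `k`, has variance `≥ 1/2592`, and EVERY influence `≤ 29/k²`. [folklore] -/
theorem chebyshev_calibration (r : ℕ) (hr : 1 ≤ r) :
    PseudoBounded (4 * (3 * r)) ((Polynomial.aeval (∑ i : Fin (144 * r ^ 2),
        (MvPolynomial.C (1 / ((144 * r ^ 2 : ℕ) : ℝ)) -
          MvPolynomial.C (2 / ((144 * r ^ 2 : ℕ) : ℝ)) * MvPolynomial.X i))
        (Polynomial.Chebyshev.T ℝ ((4 * (3 * r) : ℕ) : ℤ))) ^ 2) ∧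
    (1 / 2592 : ℝ) ≤ boolVariance ((Polynomial.aeval (∑ i : Fin (144 * r ^ 2),
        (MvPolynomial.C (1 / ((144 * r ^ 2 : ℕ) : ℝ)) -
          MvPolynomial.C (2 / ((144 * r ^ 2 : ℕ) : ℝ)) * MvPolynomial.X i))
        (Polynomial.Chebyshev.T ℝ ((4 * (3 * r) : ℕ) : ℤ))) ^ 2) ∧
    ∀ i : Fin (144 * r ^ 2), influence i ((Polynomial.aeval (∑ i : Fin (144 * r ^ 2),
        (MvPolynomial.C (1 / ((144 * r ^ 2 : ℕ) : ℝ)) -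
          MvPolynomial.C (2 / ((144 * r ^ 2 : ℕ) : ℝ)) * MvPolynomial.X i))
        (Polynomial.Chebyshev.T ℝ ((4 * (3 * r) : ℕ) : ℤ))) ^ 2) ≤ 29 / ((4 * (3 * r) : ℕ) : ℝ) ^ 2 := by
  refine ⟨pseudoBounded_chebyshevT_sq _ (by omega) (by nlinarith), boolVariance_chebyshevT_sq_ge_const r hr,
    fun i => ?_⟩
  exact influence_chebyshevT_sq_le_of_sq (N := 144 * r ^ 2) (4 * (3 * r)) (by omega) (by ring) i

/-- **No law with LINEAR loss in `T` holds on the SOS sandwich class `K`, whatever the variance exponent:**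
for every `a : ℕ` and `C > 0` there is a pseudo-bounded `p` of some order `T ≥ 1` with `Var[p] > 0` and
`maxᵢ Infᵢ[p] < C·Var[p]^a/T`. (Witness: the calibrating Chebyshev family, `Var ≥ 1/2592`, `maxInf ≤ 29/T²`,
`T = 12r → ∞`.) Since the averaged address family forces `a ≥ 2` and the top-homogeneous class attains
`maxInf = 16·Var²/T` (`SosSandwichHomogeneousPBAAT*.lean`), this shows that the corner law
`maxInf ≥ C·Var²/T` of the top-homogeneous class FAILS on `K`: off the top level the `T`-loss of PB-AA is
at least QUADRATIC, so `(a, b) = (2, 2)` — `maxInf ≥ C·Var²/T²` — is the unique strongest candidate law on `K`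
and, in the single-exponent item `PseudoBoundedAA` (`C·(ε/T)^c`), `c ≥ 2` is forced from the `T`-side too.
[folklore] -/
theorem not_influence_law_linear_in_T :
    ¬ ∃ (a : ℕ) (C : ℝ), 0 < C ∧ ∀ (N T : ℕ) (p : MvPolynomial (Fin N) ℝ), 1 ≤ T → PseudoBounded T p →
      0 < boolVariance p → ∃ i : Fin N, C * boolVariance p ^ a / T ≤ influence i p := by
  rintro ⟨a, C, hC, h⟩
  set v : ℝ := 1 / 2592 with hv
  have hv0 : 0 < v := by norm_num
  have hva : 0 < C * v ^ a := mul_pos hC (pow_pos hv0 a)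
  obtain ⟨r₀, hr₀⟩ := exists_nat_gt (29 / (C * v ^ a))
  set r := r₀ + 1 with hrdef
  have hr : 1 ≤ r := by omega
  obtain ⟨hpb, hvarP, hinfP⟩ := chebyshev_calibration r hr
  have hk1 : 1 ≤ 4 * (3 * r) := by omega
  obtain ⟨i, hi⟩ := h (144 * r ^ 2) (4 * (3 * r)) _ hk1 hpb (lt_of_lt_of_le hv0 hvarP)
  have hinf := hinfP i
  set V := boolVariance ((Polynomial.aeval (∑ i : Fin (144 * r ^ 2),
        (MvPolynomial.C (1 / ((144 * r ^ 2 : ℕ) : ℝ)) -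
          MvPolynomial.C (2 / ((144 * r ^ 2 : ℕ) : ℝ)) * MvPolynomial.X i))
        (Polynomial.Chebyshev.T ℝ ((4 * (3 * r) : ℕ) : ℤ))) ^ 2) with hV
  have hk : ((4 * (3 * r) : ℕ) : ℝ) = 12 * r := by push_cast; ring
  rw [hk] at hi hinf
  have hr0 : (0 : ℝ) < r := by exact_mod_cast (show 0 < r by omega)
  have hrr : (r₀ : ℝ) + 1 = r := by rw [hrdef]; push_cast; ring
  -- `C v^a / (12 r) ≤ C V^a / (12 r) ≤ Inf_i ≤ 29 / (12 r)²`
  have hVa : v ^ a ≤ V ^ a := pow_le_pow_left₀ hv0.le hvarP a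
  have h1 : C * v ^ a / (12 * r) ≤ 29 / (12 * r) ^ 2 :=
    le_trans (div_le_div_of_nonneg_right (mul_le_mul_of_nonneg_left hVa hC.le) (by positivity)) (hi.trans hinf)
  rw [div_le_div_iff₀ (by positivity) (by positivity)] at h1
  -- hence `C v^a · 12 r ≤ 29`, contradicting `r > 29/(C v^a)`
  have h2 : C * v ^ a * (12 * r) ≤ 29 := by nlinarith [h1, hr0]
  have h3 : 29 / (C * v ^ a) < r := by linarith [hr₀, hrr]
  rw [div_lt_iff₀ hva] at h3
  nlinarith [h2, h3, hva, hr0]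

end Summit.QuantumAdvantage.QuantumAdvantage.Theorems.SosSandwich

end
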